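import Summits.MatrixMultiplication.MatrixMultiplication.Theorems.AbelianSTPPCensusVQWitness483
import Summits.MatrixMultiplication.MatrixMultiplication.Theorems.AbelianSTPPCensusE3KShape

/-!
# The first list alive under vP ∧ E3⁺ ∧ E3K among the recorded ones: `(7,7,6)³ + (6,6,6) + (5,5,5)` at order 486 (cell mm-stpp, eng-2 g7)

Companion of `AbelianSTPPCensusVQWitness483.lean` / `…VQWitness472.lean` for the STRENGTHENED shape instrument
vQK := vP ∧ E3⁺ ∧ E3K (`SieveAdmissibleVP ∧ STPPThreeRoomEnergy.E3pAdm ∧ STPPThreeRoomEnergy.E3kAdm`; E3K = the Kneser-class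
three-room energy rule of `AbelianSTPPCensusThreeRoomEnergyKneser.lean`, shape predicate in `AbelianSTPPCensusE3KShape.lean`).
E3⁺⁺ ⊂ E3K kill the recorded vQ-alive lists at 472/473 (`no_6668x4_344_at_472/473`), 483 (`no_866_776_776_666_555_at_483`),
484 and 485 (`no_866_776_776_666_555_at_484/485`, `no_776x3_666_555_at_485`); the first recorded list E3K does not kill is
`(7,7,6)³ + (6,6,6) + (5,5,5)` at the abelian order `486 = 2·3⁵` (eng-1 g5 scan j274239 lists it among the vQ-alive leaves at 485 and 486):

* `w486_admissible` — vP-admissible at 486 (vM by evaluation; U11-G in all three letter forms; U11-P not invoked, 486 composite);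
* `w486_e3pAdm`, `w486_e3kAdm` — E3⁺- and E3K-admissible (kernel predicates, by `decide`; heavy-member E3K margin `1 517`);
* `w486_beats` — beats `5/2`: `3·294^{5/6} + 216^{5/6} + 125^{5/6} ≥ 3·114 + 88.15 + 55.9 = 486.05 > 486`.

Hence `vqkCensusTE_fails_at_486` and `vqkCensusTE_false_above_486`: no census statement built on vP ∧ E3⁺ ∧ E3K reaches an order `≥ 486`
for `T_E`; the instrument's first-alive order lies in `[474, 486]` (kernel: dead through 473 needs the certificate column, alive at 486 here;
where exactly is a question for a complete enumerator — eng-2 g7 probe kit j284161, one lineage).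
WHAT THIS IS NOT: no STPP family with these shapes is claimed to exist; no census number; no `ω` statement.
-/

-- single-conjunct summit: the mandated namespace repeats `MatrixMultiplication`.
set_option linter.dupNamespace false
set_option autoImplicit false

namespace Summit.MatrixMultiplication.MatrixMultiplication.Theorems

namespace AbelianSTPPCensusVP

open Finset STPPThreeRoomEnergy

/-! The 486 witness `(7,7,6)³ + (6,6,6) + (5,5,5)` is written inline as the size vectors `![7,7,7,6,5]`, `![7,7,7,6,5]`, `![6,6,6,6,5]`. -/

/-- The 486 witness beats `5/2` (certified sixth-power bounds `114 ≤ 294^{5/6}`, `88.15 ≤ 216^{5/6}`, `55.9 ≤ 125^{5/6}`;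
`3·114 + 88.15 + 55.9 = 486.05 > 486`). [original] -/
theorem w486_beats : Beats (5 / 2) 486 (![7, 7, 7, 6, 5] : Fin 5 → ℕ) ![7, 7, 7, 6, 5] ![6, 6, 6, 6, 5] := by
  unfold Beats
  have h1 : (114 : ℝ) ≤ (294 : ℝ) ^ ((5 : ℝ) / 6) := le_rpow_five_sixths (by norm_num) (by norm_num) (by norm_num)
  have h2 : (88.15 : ℝ) ≤ (216 : ℝ) ^ ((5 : ℝ) / 6) := le_rpow_five_sixths (by norm_num) (by norm_num) (by norm_num)
  have h3 : (55.9 : ℝ) ≤ (125 : ℝ) ^ ((5 : ℝ) / 6) := le_rpow_five_sixths (by norm_num) (by norm_num) (by norm_num)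
  have hexp : ((5 : ℝ) / 2 / 3) = (5 : ℝ) / 6 := by norm_num
  simp only [Fin.sum_univ_five, shapeVol, hexp]
  simp only [Matrix.cons_val_zero, Matrix.cons_val_one, Matrix.cons_val]
  norm_num
  linarith

set_option maxRecDepth 20000 in
/-- The 486 witness is vP-admissible at the composite order `486 = 2·3⁵` (vM by evaluation; U11-G in all three letter forms; U11-P not
invoked). [original] -/
theorem w486_admissible : SieveAdmissibleVP 486 (![7, 7, 7, 6, 5] : Fin 5 → ℕ) ![7, 7, 7, 6, 5] ![6, 6, 6, 6, 5] := by
  refine ⟨?_, ?_, fun hp => absurd hp (by norm_num)⟩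
  · refine ⟨by decide, by decide, by decide, by decide, by decide, ?_, ?_⟩
    · intro l
      refine ⟨by revert l; decide, fun h => absurd h (by revert l; decide), by revert l; decide,
        fun h => absurd h (by revert l; decide), by revert l; decide, fun h => absurd h (by revert l; decide)⟩
    · intro l
      refine ⟨fun h _ => absurd h (by revert l; decide), fun h _ => absurd h (by revert l; decide),
        fun h _ => absurd h (by revert l; decide)⟩
  · refine ⟨?_, ?_, ?_⟩ <;> (unfold U11GFormB; decide)

/-- The 486 witness is E3⁺-admissible (kernel predicate `E3pAdm`). [original] -/
theorem w486_e3pAdm : E3pAdm 486 (![7, 7, 7, 6, 5] : Fin 5 → ℕ) ![7, 7, 7, 6, 5] ![6, 6, 6, 6, 5] := by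
  intro t _
  revert t
  decide

/-- The 486 witness is E3K-admissible (kernel predicate `E3kAdm`, all three pair classes; = `e3kAdm_776x3_666_555_486`). [original] -/
theorem w486_e3kAdm : E3kAdm 486 (![7, 7, 7, 6, 5] : Fin 5 → ℕ) ![7, 7, 7, 6, 5] ![6, 6, 6, 6, 5] :=
  e3kAdm_776x3_666_555_486

/-- E3K margin of a `(7,7,6)` member of the 486 witness (pair `(A,B)` form of the data as given): off-member sums `145, 145, 159`,
`294² − e3kLHS = 2 176` (the best pair class, `(B,C)`, leaves `1 517` — seat table). [bookkeeping] -/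
theorem w486_e3k_slack : 294 ^ 2 - e3kLHS 486 7 7 6 145 145 159 = 2176 := by decide +kernel

/-- **The instrument vP ∧ E3⁺ ∧ E3K is blind at order 486 for T_E.** [original] -/
theorem vqkCensusTE_fails_at_486 :
    ∃ (N : ℕ) (a b c : Fin N → ℕ), 2 ≤ N ∧ SieveAdmissibleVP 486 a b c ∧ E3pAdm 486 a b c ∧ E3kAdm 486 a b c ∧
      Beats (5 / 2) 486 a b c :=
  ⟨5, _, _, _, by norm_num, w486_admissible, w486_e3pAdm, w486_e3kAdm, w486_beats⟩

/-- **No census statement built on vP ∧ E3⁺ ∧ E3K reaches any order `M ≥ 486` for T_E.** [original] -/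
theorem vqkCensusTE_false_above_486 {M : ℕ} (hM : 486 ≤ M) :
    ¬ (∀ (N M' : ℕ) (a b c : Fin N → ℕ), 2 ≤ N → M' ≤ M → SieveAdmissibleVP M' a b c → E3pAdm M' a b c → E3kAdm M' a b c →
        ¬ Beats (5 / 2) M' a b c) :=
  fun h => h 5 486 _ _ _ (by norm_num) hM w486_admissible w486_e3pAdm w486_e3kAdm w486_beats

end AbelianSTPPCensusVP

end Summit.MatrixMultiplication.MatrixMultiplication.Theorems
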